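import Literature.NumberTheory.Rogawski1990.StableConjugacyU3
import Literature.NumberTheory.Rogawski1990.LocalTransfer
import HarnessLib

/-!
# Regular (semisimple) STABLE CLASSES of `U(H)(F)`: the predicate `StableClass.IsRegular` and its readings at representatives
# (Rogawski (1990), §3.1 p. 19, §14.2 p. 232, §14.5 p. 238)

Topic `NumberTheory/Rogawski1990`; namespace `Literature.NumberTheory.Rogawski1990`.  ONE definition with body (`StableClass.IsRegular`, a
`Quotient.lift` of ★ `IsRegularElt` — well defined because stably conjugate elements are conjugate in the ambient `GL_n`, hence have the same
characteristic polynomial, ★ `IsStablyConj.charpoly_eq` ∕ ★ `isRegularElt_of_isConj`) and theorems; no instance, no notation, no named fact, no `sorry`.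

WHY.  The SJ sockets of the T1 engine line (`Cruxes/H413/Lines/F0_T1InnerFormTraceIdentity.lean`, SPEC-ed1.19c §3∕§5) are stated on the REGULAR stable
classes `𝒪` of `G′(L⁺) = U(H)(L⁺)` in the ∀-representative form «`∀ γ₀, 𝔨.eSt 𝒪 = stableClassOf _ _ γ₀ → IsRegularElt γ₀ → …`», and the anchored kit wants to
DEFINE `SJG 𝒪 f := if 𝒪.IsRegular then … else 0`; both need regularity as a predicate ON THE STABLE CLASS with the three readings proved here:
at any representative (`IsRegular.isRegularElt_of_eq_stableClassOf`), at the chosen representative of any conjugacy class inside the stable class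
(`IsRegular.isRegularElt_out_of_mem_conjClassesIn` — the hypothesis `hc` of ★ `UnitaryGroup.exists_finset_adelicClassOrbitalIntegral_ofLocal_eval_eq_mul_prod_of_isAdmissibleOn`
at EVERY class of a regular stable class), and through the characteristic polynomial of the class (`isRegular_iff_charpoly_separable`).  Over a
field, regular ⇒ semisimple (`IsRegular.isSemisimple`: separable characteristic polynomial ⇒ square-free annihilating polynomial, Cayley–Hamilton +
Mathlib `Module.End.isSemisimple_of_squarefree_aeval_eq_zero`), so the regular stable classes lie in Rogawski's `𝒪_st(G)` (semisimple classes).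

* §1 `IsStablyConj.isRegularElt_iff`, **`StableClass.IsRegular`**, `isRegular_stableClassOf` (`Iff.rfl`), `isRegular_ofConjClass_mk`,
  `isRegular_iff_charpoly_separable`, `IsRegular.isRegularElt_of_eq_stableClassOf`, `isRegular_ofConjClass_iff_isRegularElt_out`,
  `IsRegular.isRegularElt_out_of_mem_conjClassesIn`, `IsRegular.isRegularElt_out_of_ofConjClass_eq`.
* §2 (field) `isSemisimpleElt_of_isRegularElt`, **`StableClass.IsRegular.isSemisimple`**.

## References
* J. D. Rogawski, *Automorphic Representations of Unitary Groups in Three Variables*, Ann. of Math. Stud. 123 (1990), §3.1 p. 19, §14.2 p. 232, §14.5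
  p. 238 [Rogawski1990].
-/

set_option autoImplicit false

namespace Literature.NumberTheory.Rogawski1990

open Literature.AlgebraicGeometry.ShimuraVarieties (unitaryGroup)

/-! ## §1 Regularity of a stable class -/

section General

variable {R : Type*} [CommRing R] {n : Type*} [Fintype n] [DecidableEq n] {σ : R →+* R} {H : Matrix n n R}

/-- Stably conjugate elements are regular together (they are conjugate in `GL_n(R)`; ★ `isRegularElt_of_isConj`). [cite: Rogawski1990, §3.1 p. 19] -/
theorem IsStablyConj.isRegularElt_iff {γ δ : unitaryGroup σ H} (h : IsStablyConj σ H γ δ) :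
    IsRegularElt (γ : GL n R) ↔ IsRegularElt (δ : GL n R) :=
  ⟨isRegularElt_of_isConj h, isRegularElt_of_isConj h.symm⟩

/-- **A stable class is REGULAR** if its elements are regular semisimple (★ `IsRegularElt`: separable characteristic polynomial) — well defined by
`IsStablyConj.isRegularElt_iff`.  Rogawski's «regular elliptic `𝒪_st`» of §14.5 are the regular ones among the (elliptic) stable classes of the anisotropic
`G′`. [cite: Rogawski1990, §3.1 p. 19; §14.5 p. 238] -/
def StableClass.IsRegular : StableClass σ H → Prop :=
  Quotient.lift (fun γ : unitaryGroup σ H => IsRegularElt (γ : GL n R)) fun _ _ h => propext (IsStablyConj.isRegularElt_iff h)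

/-- `𝒪_st(γ)` is regular iff `γ` is. [cite: Rogawski1990, §3.1 p. 19] -/
@[simp] theorem StableClass.isRegular_stableClassOf (γ : unitaryGroup σ H) :
    (stableClassOf σ H γ).IsRegular ↔ IsRegularElt (γ : GL n R) :=
  Iff.rfl

/-- The stable class of the conjugacy class `⟦γ⟧` is regular iff `γ` is. [cite: Rogawski1990, §3.1 p. 19] -/
@[simp] theorem StableClass.isRegular_ofConjClass_mk (γ : unitaryGroup σ H) :
    (StableClass.ofConjClass (ConjClasses.mk γ)).IsRegular ↔ IsRegularElt (γ : GL n R) :=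
  Iff.rfl

/-- Regularity of a stable class is separability of ITS characteristic polynomial (★ `StableClass.charpoly`). [cite: Rogawski1990, §3.1 p. 19] -/
theorem StableClass.isRegular_iff_charpoly_separable (𝒪 : StableClass σ H) : 𝒪.IsRegular ↔ 𝒪.charpoly.Separable := by
  obtain ⟨γ, rfl⟩ := stableClassOf_surjective 𝒪
  rfl

/-- **The ∀-representative reading**: a regular stable class has EVERY representative regular — the form in which the T1 line's SJ sockets quantify
(«`∀ γ₀, eSt 𝒪 = stableClassOf _ _ γ₀ → …`»). [cite: Rogawski1990, §14.5 p. 238] -/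
theorem StableClass.IsRegular.isRegularElt_of_eq_stableClassOf {𝒪 : StableClass σ H} (h : 𝒪.IsRegular) {γ₀ : unitaryGroup σ H}
    (he : 𝒪 = stableClassOf σ H γ₀) : IsRegularElt (γ₀ : GL n R) := by
  subst he
  exact h

/-- Conversely, one regular representative makes the stable class regular. [cite: Rogawski1990, §14.5 p. 238] -/
theorem StableClass.isRegular_of_eq_stableClassOf {𝒪 : StableClass σ H} {γ₀ : unitaryGroup σ H} (he : 𝒪 = stableClassOf σ H γ₀)
    (h : IsRegularElt (γ₀ : GL n R)) : 𝒪.IsRegular := by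
  subst he
  exact h

/-- The stable class of a conjugacy class `c` is regular iff the chosen representative `out c` is regular. [cite: Rogawski1990, §3.1 p. 19] -/
theorem StableClass.isRegular_ofConjClass_iff_isRegularElt_out (c : ConjClasses (unitaryGroup σ H)) :
    (StableClass.ofConjClass c).IsRegular ↔ IsRegularElt ((Quotient.out c : unitaryGroup σ H) : GL n R) := by
  conv_lhs => rw [← Quotient.out_eq c]
  exact StableClass.isRegular_ofConjClass_mk (Quotient.out c)

/-- **At the chosen representative of EVERY conjugacy class inside a regular stable class** `𝒪_st(γ)`: `out c` is regular for `c ∈ conjClassesIn γ` —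
the regularity hypothesis of the orbital Euler product (★ `UnitaryGroup.exists_finset_adelicClassOrbitalIntegral_ofLocal_eval_eq_mul_prod_of_isAdmissibleOn`)
at each class of the stable orbital sum `Σ_{[γ′] ⊂ 𝒪_st(γ)}`. [cite: Rogawski1990, §14.5 p. 238; §4.1 (4.1.1) p. 39] -/
theorem StableClass.IsRegular.isRegularElt_out_of_mem_conjClassesIn {γ : unitaryGroup σ H} (h : (stableClassOf σ H γ).IsRegular)
    {c : ConjClasses (unitaryGroup σ H)} (hc : c ∈ conjClassesIn σ H γ) :
    IsRegularElt ((Quotient.out c : unitaryGroup σ H) : GL n R) := by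
  have hc' : StableClass.ofConjClass c = stableClassOf σ H γ := hc
  exact (StableClass.isRegular_ofConjClass_iff_isRegularElt_out c).1 (hc' ▸ h)

/-- The same, indexed by the stable class: `ofConjClass c = 𝒪` regular ⇒ `out c` regular. [cite: Rogawski1990, §14.5 p. 238] -/
theorem StableClass.IsRegular.isRegularElt_out_of_ofConjClass_eq {𝒪 : StableClass σ H} (h : 𝒪.IsRegular) {c : ConjClasses (unitaryGroup σ H)}
    (hc : StableClass.ofConjClass c = 𝒪) : IsRegularElt ((Quotient.out c : unitaryGroup σ H) : GL n R) :=
  (StableClass.isRegular_ofConjClass_iff_isRegularElt_out c).1 (hc ▸ h)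

/-- A regular element's conjugacy class has a regular chosen representative. [cite: Rogawski1990, §3.1 p. 19] -/
theorem isRegularElt_out_conjClassesMk {γ : unitaryGroup σ H} (h : IsRegularElt (γ : GL n R)) :
    IsRegularElt ((Quotient.out (ConjClasses.mk γ) : unitaryGroup σ H) : GL n R) :=
  (StableClass.isRegular_ofConjClass_iff_isRegularElt_out (ConjClasses.mk γ)).1 h

end General

/-! ## §2 Over a field: regular ⇒ semisimple -/

section Field

variable {K : Type*} [Field K] {n : Type*} [Fintype n] [DecidableEq n] {σ : K →+* K} {H : Matrix n n K}

/-- **Regular semisimple elements are semisimple** (over a field): the characteristic polynomial is separable, hence square-free, and annihilates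
the endomorphism `v ↦ γ v` (Cayley–Hamilton), so that endomorphism is semisimple (Mathlib `Module.End.isSemisimple_of_squarefree_aeval_eq_zero`).
[cite: Rogawski1990, §3.1 p. 19] -/
theorem isSemisimpleElt_of_isRegularElt {γ : unitaryGroup σ H} (h : IsRegularElt (γ : GL n K)) : IsSemisimpleElt σ H γ := by
  unfold IsSemisimpleElt
  refine Module.End.isSemisimple_of_squarefree_aeval_eq_zero h.squarefree ?_
  have hM : Matrix.toLin' ((γ : GL n K) : Matrix n n K) = Matrix.toLinAlgEquiv' ((γ : GL n K) : Matrix n n K) := rfl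
  rw [hM, Polynomial.aeval_algHom_apply, Matrix.aeval_self_charpoly, map_zero]

/-- **A regular stable class is semisimple** — the regular classes of the SJ sockets lie in Rogawski's `𝒪_st(G)` (stable classes of semisimple
elements). [cite: Rogawski1990, §3.1 p. 19; §14.5 p. 238] -/
theorem StableClass.IsRegular.isSemisimple {𝒪 : StableClass σ H} (h : 𝒪.IsRegular) : 𝒪.IsSemisimple := by
  obtain ⟨γ, rfl⟩ := stableClassOf_surjective 𝒪
  exact (StableClass.isSemisimple_stableClassOf γ).2 (isSemisimpleElt_of_isRegularElt h)

end Field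

end Literature.NumberTheory.Rogawski1990
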